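import Summits.CriticalPhenomena.PercolationContinuityZ3.Theorems.FK.TranslationAveragesFK
import Mathlib.MeasureTheory.Function.ConvergenceInMeasure
import Mathlib.MeasureTheory.Measure.MutuallySingular
import HarnessLib

/-!
# FK-continuity cell, FO-10a: DICHOTOMY — two of the random-cluster measures `φ^b_{p,q}` on `ℤ^d`
# (`b ∈ {0,1}`, `0 ≤ p ≤ 1`, `q ≥ 1`) are either EQUAL or MUTUALLY SINGULAR; in particular
# `φ⁰_{p,q} ≠ φ¹_{p,q} ⇒ φ⁰_{p,q} ⟂ φ¹_{p,q}`

Registered R112 (cell INBOX l.7604, 2026-08-25); registry row FO-10a-g342s; label SNG-A (coordinator fk-4 g228).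
Cell `fk-continuity` (bschramm), row FO-10a (pressure layer); support file for the FK-continuity transplant
(`--supports stmt-CriticalPhenomena-4575`); builds on p205010 (kernel theorem, internal audit signed; external expert
review pending). Pure proofs; no definitions, no named facts, no sorries; every `d ≥ 1`. UNCONDITIONAL infinite-volume
structure; it decides nothing about FH / TP_FK / whether `φ⁰ = φ¹` at any particular `(p,q)`.

The law of large numbers of `TranslationAveragesFK.lean` makes every local-event probability `φ^b_{p,q}(A)` an
almost-sure INVARIANT of the measure along a subsequence of boxes: the density of sites where `A` occurs converges to
`φ^b_{p,q}(A)` in `φ^b_{p,q}`-probability, hence a.e. along a subsequence. Two of the measures giving different mass to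
one increasing cylinder `{E₀ ⊆ ω}` (and by `InfiniteVolumeCylinders.ext_of_setOf_subset` two DISTINCT such measures
always do) therefore live on disjoint measurable sets. This is the tree's form of "distinct ergodic translation-invariant
measures are mutually singular" for the extremal random-cluster measures (Grimmett 2006, Thm. (4.19)(d), Cor. (4.23)),
without the ergodic theorem:

* `mutuallySingular_of_tendstoInMeasure_const_ne` — GENERIC: if measurable `f_n → a` in `μ`-probability and
  `f_n → b` in `ν`-probability with `a ≠ b`, then `μ ⟂ₘ ν` (two subsequence extractions, Mathlib's
  `TendstoInMeasure.exists_seq_tendsto_ae`);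
* `tendstoInMeasure_density_box_rcLimit` — the local-event density along boxes tends to `φ^b_{p,q}(A)` in
  `φ^b_{p,q}`-measure (Mathlib's `TendstoInMeasure` packaging of `TranslationAveragesFK.lean`);
* **`rcLimit_mutuallySingular_of_ne`** — `rcLimit d b p q ≠ rcLimit d b' p' q' → rcLimit d b p q ⟂ₘ rcLimit d b' p' q'`
  (`d ≥ 1`; `0 ≤ p, p' ≤ 1`; `q, q' ≥ 1`); **`rcLimit_eq_or_mutuallySingular`** — the dichotomy; and
  **`rcLimit_false_ne_true_iff_mutuallySingular`** — `φ⁰_{p,q} ≠ φ¹_{p,q} ↔ φ⁰_{p,q} ⟂ₘ φ¹_{p,q}`: at a point of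
  non-uniqueness the free and wired phases are carried by disjoint events.

## References

* G. Grimmett, *The Random-Cluster Model*, Springer 2006 (`book:grimmett2006-random-cluster-model`): §4.3
  Thm. (4.19)(d), Cor. (4.23) (ergodicity of `φ^b_{p,q}`) [PDF pp. 77–79]; §4.4 (non-uniqueness, `φ⁰ ≠ φ¹`). [Grimmett2006]
-/

noncomputable section

open MeasureTheory Set Filter Finset
open scoped Topology ENNReal

namespace Summit.CriticalPhenomena.PercolationContinuityZ3.Theorems.FK

open Literature.Probability.Percolation Literature.Probability.LatticeModels

/-! ### Generic: different in-probability limits force mutual singularity -/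

/-- **If `f_n → a` in `μ`-probability and `f_n → b` in `ν`-probability with `a ≠ b`, then `μ ⟂ₘ ν`.** Along a
subsequence `f → a` `μ`-a.e., along a further subsequence also `f → b` `ν`-a.e.; the event "the sub-subsequence tends
to `a`" is `μ`-full and, limits in `ℝ` being unique, `ν`-null. [folklore] -/
theorem mutuallySingular_of_tendstoInMeasure_const_ne {Ω : Type*} [MeasurableSpace Ω] {μ ν : Measure Ω}
    {f : ℕ → Ω → ℝ} {a b : ℝ} (hμ : TendstoInMeasure μ f atTop fun _ => a)
    (hν : TendstoInMeasure ν f atTop fun _ => b) (hab : a ≠ b) : μ ⟂ₘ ν := by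
  obtain ⟨ns, hns, hμae⟩ := hμ.exists_seq_tendsto_ae
  obtain ⟨ns', hns', hνae⟩ := (hν.comp hns.tendsto_atTop).exists_seq_tendsto_ae
  have hμae' : ∀ᵐ ω ∂μ, Tendsto (fun i => f (ns (ns' i)) ω) atTop (𝓝 a) :=
    hμae.mono fun ω hω => hω.comp hns'.tendsto_atTop
  refine Measure.MutuallySingular.mk (s := {ω | Tendsto (fun i => f (ns (ns' i)) ω) atTop (𝓝 a)}ᶜ)
    (t := {ω | Tendsto (fun i => f (ns (ns' i)) ω) atTop (𝓝 a)}) ?_ ?_ (fun ω _ => (em _).symm)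
  · exact measure_eq_zero_iff_ae_notMem.2 (hμae'.mono fun ω hω => by rwa [Set.mem_compl_iff, not_not])
  · exact measure_eq_zero_iff_ae_notMem.2 (hνae.mono fun ω hω hωa => hab (tendsto_nhds_unique hωa hω))

variable {d : ℕ}

/-! ### The local-event densities of `φ^b_{p,q}` converge in measure -/

/-- The density of sites of `Λ_n` where the local event `A` occurs tends to `φ^b_{p,q}(A)` IN `φ^b_{p,q}`-MEASURE
(Mathlib's `TendstoInMeasure`; `d ≥ 1`). [cite: Grimmett2006, Cor. (4.23)] -/
theorem tendstoInMeasure_density_box_rcLimit (hd : 0 < d) (b : Bool) {p q : ℝ} (hp : p ∈ Set.Icc (0 : ℝ) 1)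
    (hq : 1 ≤ q) {A : Set (BondConfig (Site d))} (hA : IsLocalEvent A) :
    TendstoInMeasure (rcLimit d b p q) (fun (n : ℕ) (ω : BondConfig (Site d)) => (#(box d n) : ℝ)⁻¹ *
        ∑ x ∈ box d n, (BondConfig.relabel (sym2Equiv (Site.shift (-x))) ⁻¹' A).indicator
          (1 : BondConfig (Site d) → ℝ) ω) atTop (fun _ => (rcLimit d b p q).real A) := by
  haveI := isProbabilityMeasure_rcLimit (d := d) b p q
  rw [tendstoInMeasure_iff_measureReal_dist]
  intro δ hδ
  simp_rw [Real.dist_eq]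
  exact tendsto_rcLimit_real_le_abs_density_box_sub hd b hp hq hA hδ

/-! ### The dichotomy -/

/-- **Two DISTINCT random-cluster measures `φ^b_{p,q} ≠ φ^{b'}_{p',q'}` on `ℤ^d` (`d ≥ 1`, `0 ≤ p, p' ≤ 1`, `q, q' ≥ 1`)
are MUTUALLY SINGULAR.** They differ on some increasing cylinder `{E₀ ⊆ ω}` (`ext_of_setOf_subset`), whose density of
occurrences then has different in-measure limits under the two measures. [cite: Grimmett2006, Thm. (4.19)(d), Cor. (4.23)] -/
theorem rcLimit_mutuallySingular_of_ne (hd : 0 < d) {b b' : Bool} {p p' q q' : ℝ} (hp : p ∈ Set.Icc (0 : ℝ) 1)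
    (hq : 1 ≤ q) (hp' : p' ∈ Set.Icc (0 : ℝ) 1) (hq' : 1 ≤ q') (hne : rcLimit d b p q ≠ rcLimit d b' p' q') :
    rcLimit d b p q ⟂ₘ rcLimit d b' p' q' := by
  haveI := isProbabilityMeasure_rcLimit (d := d) b p q
  haveI := isProbabilityMeasure_rcLimit (d := d) b' p' q'
  obtain ⟨E₀, hE₀⟩ : ∃ E₀ : Finset (Sym2 (Site d)),
      rcLimit d b p q {ω : BondConfig (Site d) | (↑E₀ : Set (Sym2 (Site d))) ⊆ ω} ≠
        rcLimit d b' p' q' {ω : BondConfig (Site d) | (↑E₀ : Set (Sym2 (Site d))) ⊆ ω} := by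
    by_contra h
    push Not at h
    exact hne (ext_of_setOf_subset h)
  have hreal : (rcLimit d b p q).real {ω : BondConfig (Site d) | (↑E₀ : Set (Sym2 (Site d))) ⊆ ω} ≠
      (rcLimit d b' p' q').real {ω : BondConfig (Site d) | (↑E₀ : Set (Sym2 (Site d))) ⊆ ω} := by
    rw [measureReal_def, measureReal_def, Ne, ENNReal.toReal_eq_toReal_iff' (measure_ne_top _ _) (measure_ne_top _ _)]
    exact hE₀
  exact mutuallySingular_of_tendstoInMeasure_const_ne
    (tendstoInMeasure_density_box_rcLimit hd b hp hq (isLocalEvent_setOf_subset E₀))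
    (tendstoInMeasure_density_box_rcLimit hd b' hp' hq' (isLocalEvent_setOf_subset E₀)) hreal

/-- **DICHOTOMY: any two of the measures `φ^b_{p,q}` are equal or mutually singular** (`d ≥ 1`).
[cite: Grimmett2006, Thm. (4.19)(d), Cor. (4.23)] -/
theorem rcLimit_eq_or_mutuallySingular (hd : 0 < d) {b b' : Bool} {p p' q q' : ℝ} (hp : p ∈ Set.Icc (0 : ℝ) 1)
    (hq : 1 ≤ q) (hp' : p' ∈ Set.Icc (0 : ℝ) 1) (hq' : 1 ≤ q') :
    rcLimit d b p q = rcLimit d b' p' q' ∨ rcLimit d b p q ⟂ₘ rcLimit d b' p' q' :=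
  or_iff_not_imp_left.2 (rcLimit_mutuallySingular_of_ne hd hp hq hp' hq')

/-- **At a point of non-uniqueness the free and wired phases are mutually singular:
`φ⁰_{p,q} ≠ φ¹_{p,q} ↔ φ⁰_{p,q} ⟂ₘ φ¹_{p,q}`** (`d ≥ 1`, `0 ≤ p ≤ 1`, `q ≥ 1`).
[cite: Grimmett2006, §4.4 with Thm. (4.19)(d), Cor. (4.23)] -/
theorem rcLimit_false_ne_true_iff_mutuallySingular (hd : 0 < d) {p q : ℝ} (hp : p ∈ Set.Icc (0 : ℝ) 1)
    (hq : 1 ≤ q) : rcLimit d false p q ≠ rcLimit d true p q ↔ rcLimit d false p q ⟂ₘ rcLimit d true p q := by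
  refine ⟨rcLimit_mutuallySingular_of_ne hd hp hq hp hq, fun h heq => ?_⟩
  haveI := isProbabilityMeasure_rcLimit (d := d) false p q
  rw [← heq, Measure.MutuallySingular.self_iff] at h
  exact IsProbabilityMeasure.ne_zero (rcLimit d false p q) h

end Summit.CriticalPhenomena.PercolationContinuityZ3.Theorems.FK

end
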